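import Literature.AlgebraicGeometry.Motives.HodgeThetaSubalgebraUnitaryAnnihilatorIdealTop
import Mathlib.LinearAlgebra.Trace
import HarnessLib

/-!
# The `Θ`-subalgebra theorem beyond coprime multiplicities, VI: the `2 × 2` BLOCK UNITS of the tensor skeleton — a second
# system of matrix units `P_ab ∈ 𝔊`, commuting with the `3 × 3` units, with `Σ P_aa = 1` and `tr(P₁₁E₁) = 1`
# (the factor `𝔤𝔩₂ ⊗ 1` of Moonen–Zarhin's `𝔤𝔩₂ ⊗ 1 + 1 ⊗ 𝔤𝔩₃`; classification-free)

Family `hodge`, layer `Literature/AlgebraicGeometry/Motives` (pure complex linear algebra; no geometry). Written for the cell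
`pub-hodgeav-hg6` (req-37 (A) row 2 «base of HC ladder», TABLE X row 8-`(4,2)`, crux `UnitaryThetaCore.top_or_radical_two_four`;
eng-5 lineage g5, brick V3b; honest framing of that cell: HC / HC_AV / HC_CM / H2 NOT proved — THIS file is unconditional linear
algebra and discharges no hypothesis of the cell's cover). UNCONDITIONAL; theorems only — no definition, no named fact (D-0026),
no `sorry`.

SETTING (the output of brick V3 `UnitaryFourTwo.exists_matrix_units`, as hypotheses): operators `e, C, E₁, U, V` on `W` with
`eE₁ = e`, `VE₁ = V`, `E₁C = C`, `E₁U = U`, `E₁² = E₁`, `eC + E₁ + VU = 1`, `rank E₁ = 2`, and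
FULLNESS: every block `E₁yE₁` is the block of some `S ∈ 𝔊` commuting with `e, C, E₁, U, V`.

WHAT IS PROVED — **`UnitaryFourTwo.exists_block_units`**: there are `P₁₁, P₁₂, P₂₁, P₂₂ ∈ 𝔊` commuting with
`e, C, E₁, U, V`, with the `2 × 2` MATRIX-UNIT RELATIONS `P_ab P_cd = δ_bc P_ad`, `P₁₁ + P₂₂ = 1`, `tr_W(P₁₁E₁) = 1`, and
every operator commuting with `e, C, E₁, U, V` is a combination `Σ s_ab P_ab` (an element commuting with the `3 × 3` units is
`e·s·C + s + V·s·U` for its block `s = E₁SE₁`; the `P_ab` are the commuting lifts of the rank-one block operators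
`x_a ⊗ ξ_b` of a basis `x₁, x₂` of `range E₁`).
SEQUEL: brick V4 (radical of `tr_W − ¾κ` on the derived algebra of a `2 ⊗ 3` matrix-unit skeleton), V5 (assembly).

## References
* [MoonenZarhin1999LowDim] B. Moonen, Yu. Zarhin, Math. Ann. 315 (1999), §2 (2.5).
* [Humphreys1972] J. E. Humphreys, *Introduction to Lie Algebras and Representation Theory*, §19.1 (matrix units of `𝔤𝔩`).
* [HoffmanKunze1971LinearAlgebra] K. Hoffman, R. Kunze, *Linear Algebra*, §3.5 (dual bases), §6.7 (projections).
-/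

noncomputable section

open Module

namespace Literature.AlgebraicGeometry.Motives

namespace HodgeStructure

variable {W : Type*} [AddCommGroup W] [Module ℂ W]

/-- **The `2 × 2` block units of the tensor skeleton.** (Module docstring.) [cite: MoonenZarhin1999LowDim, §2 (2.5)]
[cite: Humphreys1972, §19.1] [cite: HoffmanKunze1971LinearAlgebra, §3.5] -/
theorem UnitaryFourTwo.exists_block_units [FiniteDimensional ℂ W] {𝔊 : Submodule ℂ (Module.End ℂ W)}
    {e C E₁ U V : Module.End ℂ W}
    (heE₁ : e * E₁ = e) (hVE₁ : V * E₁ = V) (hE₁C : E₁ * C = C) (hE₁U : E₁ * U = U) (hE₁E₁ : E₁ * E₁ = E₁)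
    (hunits : e * C + E₁ + V * U = 1)
    (hr₁ : finrank ℂ (LinearMap.range E₁) = 2)
    (hfull : ∀ y : Module.End ℂ W, ∃ S ∈ 𝔊,
      (S * e = e * S ∧ S * C = C * S ∧ S * E₁ = E₁ * S ∧ S * U = U * S ∧ S * V = V * S) ∧ E₁ * S * E₁ = E₁ * y * E₁) :
    ∃ P₁₁ P₁₂ P₂₁ P₂₂ : Module.End ℂ W,
      (P₁₁ ∈ 𝔊 ∧ P₁₂ ∈ 𝔊 ∧ P₂₁ ∈ 𝔊 ∧ P₂₂ ∈ 𝔊) ∧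
      (∀ P ∈ ({P₁₁, P₁₂, P₂₁, P₂₂} : Set (Module.End ℂ W)),
        P * e = e * P ∧ P * C = C * P ∧ P * E₁ = E₁ * P ∧ P * U = U * P ∧ P * V = V * P) ∧
      (P₁₁ * P₁₁ = P₁₁ ∧ P₁₁ * P₁₂ = P₁₂ ∧ P₁₂ * P₂₁ = P₁₁ ∧ P₁₂ * P₂₂ = P₁₂ ∧ P₂₁ * P₁₁ = P₂₁ ∧ P₂₁ * P₁₂ = P₂₂ ∧
        P₂₂ * P₂₁ = P₂₁ ∧ P₂₂ * P₂₂ = P₂₂) ∧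
      (P₁₁ * P₂₁ = 0 ∧ P₁₁ * P₂₂ = 0 ∧ P₁₂ * P₁₁ = 0 ∧ P₁₂ * P₁₂ = 0 ∧ P₂₁ * P₂₁ = 0 ∧ P₂₁ * P₂₂ = 0 ∧
        P₂₂ * P₁₁ = 0 ∧ P₂₂ * P₁₂ = 0) ∧
      P₁₁ + P₂₂ = 1 ∧ LinearMap.trace ℂ W (P₁₁ * E₁) = 1 ∧
      (∀ S : Module.End ℂ W, S * e = e * S → S * C = C * S → S * E₁ = E₁ * S → S * U = U * S → S * V = V * S →
        ∃ s₁₁ s₁₂ s₂₁ s₂₂ : ℂ, S = s₁₁ • P₁₁ + s₁₂ • P₁₂ + s₂₁ • P₂₁ + s₂₂ • P₂₂) := by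
  classical
  -- an operator commuting with the `3 × 3` units is determined by its block `E₁ S E₁`
  have hdet : ∀ S : Module.End ℂ W, S * e = e * S → S * C = C * S → S * E₁ = E₁ * S → S * U = U * S →
      S * V = V * S → S = e * (E₁ * S * E₁) * C + E₁ * S * E₁ + V * (E₁ * S * E₁) * U := by
    intro S hSe hSC hSE₁ hSU hSV
    have ht1 : e * (E₁ * S * E₁) * C = e * S * C := by
      rw [← mul_assoc, ← mul_assoc, heE₁, mul_assoc (e * S), hE₁C]
    have ht2 : E₁ * S * E₁ = S * E₁ := by rw [← hSE₁, mul_assoc, hE₁E₁]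
    have ht3 : V * (E₁ * S * E₁) * U = V * S * U := by
      rw [← mul_assoc, ← mul_assoc, hVE₁, mul_assoc (V * S), hE₁U]
    calc S = S * (e * C + E₁ + V * U) := by rw [hunits, mul_one]
      _ = e * S * C + S * E₁ + V * S * U := by rw [mul_add, mul_add, ← mul_assoc, hSe, ← mul_assoc S V U, hSV]
      _ = e * (E₁ * S * E₁) * C + E₁ * S * E₁ + V * (E₁ * S * E₁) * U := by rw [ht1, ht3, ht2]
  have hdet' : ∀ S S' : Module.End ℂ W, S * e = e * S → S * C = C * S → S * E₁ = E₁ * S → S * U = U * S →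
      S * V = V * S → S' * e = e * S' → S' * C = C * S' → S' * E₁ = E₁ * S' → S' * U = U * S' → S' * V = V * S' →
      E₁ * S * E₁ = E₁ * S' * E₁ → S = S' := by
    intro S S' h1e h1C h1E h1U h1V h2e h2C h2E h2U h2V hblk
    rw [hdet S h1e h1C h1E h1U h1V, hdet S' h2e h2C h2E h2U h2V, hblk]
  -- a basis of `range E₁` and its dual functionals pulled back along `E₁`
  set A : Submodule ℂ W := LinearMap.range E₁ with hAdef
  have hmemA : ∀ x, E₁ x = x ↔ x ∈ A := fun x =>
    ⟨fun h => ⟨x, h⟩, by rintro ⟨w, rfl⟩; rw [← Module.End.mul_apply, hE₁E₁]⟩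
  let b : Module.Basis (Fin 2) ℂ A := Module.finBasisOfFinrankEq ℂ A hr₁
  let x : Fin 2 → W := fun a => (b a : W)
  let ξ : Fin 2 → Module.Dual ℂ W := fun a => (b.coord a) ∘ₗ E₁.rangeRestrict
  have hxA : ∀ a, E₁ (x a) = x a := fun a => (hmemA _).2 (b a).2
  have hξx : ∀ a c, ξ a (x c) = if c = a then 1 else 0 := by
    intro a c
    have hrr : E₁.rangeRestrict (x c) = b c := Subtype.ext (by
      change E₁ (x c) = x c
      exact hxA c)
    change b.coord a (E₁.rangeRestrict (x c)) = _
    rw [hrr]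
    change b.repr (b c) a = _
    rw [b.repr_self, Finsupp.single_apply]
  have hξE : ∀ a, ξ a ∘ₗ E₁ = ξ a := by
    intro a
    refine LinearMap.ext fun w => ?_
    have hrr : E₁.rangeRestrict (E₁ w) = E₁.rangeRestrict w := Subtype.ext (by
      change E₁ (E₁ w) = E₁ w
      rw [← Module.End.mul_apply, hE₁E₁])
    change b.coord a (E₁.rangeRestrict (E₁ w)) = b.coord a (E₁.rangeRestrict w)
    rw [hrr]
  have hexpand : ∀ w, E₁ w = ξ 0 w • x 0 + ξ 1 w • x 1 := by
    intro w
    have h := congrArg Subtype.val (b.sum_repr (E₁.rangeRestrict w))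
    rw [Fin.sum_univ_two, Submodule.coe_add, Submodule.coe_smul, Submodule.coe_smul] at h
    exact h.symm
  -- the rank-one block operators `y a c = x_a ⊗ ξ_c`
  let y : Fin 2 → Fin 2 → Module.End ℂ W := fun a c => (ξ c).smulRight (x a)
  have hyapply : ∀ a c w, y a c w = ξ c w • x a := fun a c w => rfl
  have hE₁y : ∀ a c, E₁ * y a c = y a c := fun a c => by
    change E₁ * (ξ c).smulRight (x a) = (ξ c).smulRight (x a)
    rw [UnitaryTwoOdd.mul_smulRight, hxA]
  have hyE₁ : ∀ a c, y a c * E₁ = y a c := fun a c => by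
    change (ξ c).smulRight (x a) * E₁ = (ξ c).smulRight (x a)
    rw [UnitaryTwoOdd.smulRight_mul, hξE]
  have hyy : ∀ a c a' c', y a c * y a' c' = (if a' = c then (1 : ℂ) else 0) • y a c' := fun a c a' c' => by
    change (ξ c).smulRight (x a) * (ξ c').smulRight (x a') = _ • (ξ c').smulRight (x a)
    rw [UnitaryTwoOdd.smulRight_mul_smulRight, hξx]
  have hysum : y 0 0 + y 1 1 = E₁ := by
    refine LinearMap.ext fun w => ?_
    rw [LinearMap.add_apply, hyapply, hyapply, hexpand w]
  -- the block units `P a c ∈ 𝔊` (fullness)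
  have hfull' : ∀ a c : Fin 2, ∃ S ∈ 𝔊, (S * e = e * S ∧ S * C = C * S ∧ S * E₁ = E₁ * S ∧ S * U = U * S ∧
      S * V = V * S) ∧ E₁ * S * E₁ = y a c := fun a c => by
    obtain ⟨S, hS, hcomm, hblk⟩ := hfull (y a c)
    exact ⟨S, hS, hcomm, by rw [hblk, mul_assoc, hyE₁, hE₁y]⟩
  choose P hP𝔊 hPcomm hPblk using hfull'
  -- block of a product and of a sum
  have hblkE : ∀ S : Module.End ℂ W, S * E₁ = E₁ * S → E₁ * S * E₁ = S * E₁ := fun S hSE₁ => by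
    rw [← hSE₁, mul_assoc, hE₁E₁]
  have hPprod : ∀ a c a' c', P a c * P a' c' = (if a' = c then (1 : ℂ) else 0) • P a c' := by
    intro a c a' c'
    obtain ⟨h1e, h1C, h1E, h1U, h1V⟩ := hPcomm a c
    obtain ⟨h2e, h2C, h2E, h2U, h2V⟩ := hPcomm a' c'
    obtain ⟨h3e, h3C, h3E, h3U, h3V⟩ := hPcomm a c'
    refine hdet' _ _ ?_ ?_ ?_ ?_ ?_ ?_ ?_ ?_ ?_ ?_ ?_
    · rw [mul_assoc, h2e, ← mul_assoc, h1e, mul_assoc]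
    · rw [mul_assoc, h2C, ← mul_assoc, h1C, mul_assoc]
    · rw [mul_assoc, h2E, ← mul_assoc, h1E, mul_assoc]
    · rw [mul_assoc, h2U, ← mul_assoc, h1U, mul_assoc]
    · rw [mul_assoc, h2V, ← mul_assoc, h1V, mul_assoc]
    · rw [smul_mul_assoc, mul_smul_comm, h3e]
    · rw [smul_mul_assoc, mul_smul_comm, h3C]
    · rw [smul_mul_assoc, mul_smul_comm, h3E]
    · rw [smul_mul_assoc, mul_smul_comm, h3U]
    · rw [smul_mul_assoc, mul_smul_comm, h3V]
    · -- blocks: `E₁ (P P') E₁ = (E₁ P E₁)(E₁ P' E₁) = y y' = δ y`, and `E₁ (δ P) E₁ = δ y`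
      have hPPE : P a c * P a' c' * E₁ = E₁ * (P a c * P a' c') := by
        rw [mul_assoc, h2E, ← mul_assoc, h1E, mul_assoc]
      have hL : E₁ * (P a c * P a' c') * E₁ = (E₁ * P a c * E₁) * (E₁ * P a' c' * E₁) := by
        rw [hblkE _ h1E, hblkE _ h2E, hblkE _ hPPE, mul_assoc (P a c) E₁, ← mul_assoc E₁ (P a' c'), ← h2E,
          mul_assoc (P a' c') E₁ E₁, hE₁E₁, ← mul_assoc]
      rw [hL, hPblk, hPblk, hyy, mul_smul_comm, smul_mul_assoc, hPblk]
  have hPsum : P 0 0 + P 1 1 = 1 := by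
    obtain ⟨h1e, h1C, h1E, h1U, h1V⟩ := hPcomm 0 0
    obtain ⟨h2e, h2C, h2E, h2U, h2V⟩ := hPcomm 1 1
    refine hdet' _ _ ?_ ?_ ?_ ?_ ?_ (by rw [one_mul, mul_one]) (by rw [one_mul, mul_one])
      (by rw [one_mul, mul_one]) (by rw [one_mul, mul_one]) (by rw [one_mul, mul_one]) ?_
    · rw [add_mul, mul_add, h1e, h2e]
    · rw [add_mul, mul_add, h1C, h2C]
    · rw [add_mul, mul_add, h1E, h2E]
    · rw [add_mul, mul_add, h1U, h2U]
    · rw [add_mul, mul_add, h1V, h2V]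
    · rw [mul_add, add_mul, hPblk, hPblk, hysum, mul_one, hE₁E₁]
  have htrace : LinearMap.trace ℂ W (P 0 0 * E₁) = 1 := by
    obtain ⟨-, -, h1E, -, -⟩ := hPcomm 0 0
    rw [← hblkE _ h1E, hPblk]
    change LinearMap.trace ℂ W ((ξ 0).smulRight (x 0)) = 1
    rw [LinearMap.trace_smulRight, hξx]
    simp
  -- every commuting operator is a combination of the `P a c`
  have hspan : ∀ S : Module.End ℂ W, S * e = e * S → S * C = C * S → S * E₁ = E₁ * S → S * U = U * S →
      S * V = V * S → ∃ s₁₁ s₁₂ s₂₁ s₂₂ : ℂ, S = s₁₁ • P 0 0 + s₁₂ • P 0 1 + s₂₁ • P 1 0 + s₂₂ • P 1 1 := by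
    intro S hSe hSC hSE hSU hSV
    -- coordinates of the block
    let s : Fin 2 → Fin 2 → ℂ := fun a c => ξ a (S (x c))
    have hSx : ∀ c, S (x c) = s 0 c • x 0 + s 1 c • x 1 := fun c => by
      have h : E₁ (S (x c)) = S (x c) := by rw [← Module.End.mul_apply, ← hSE, Module.End.mul_apply, hxA]
      rw [← h, hexpand]
    have hblk : E₁ * S * E₁ = s 0 0 • y 0 0 + s 0 1 • y 0 1 + s 1 0 • y 1 0 + s 1 1 • y 1 1 := by
      refine LinearMap.ext fun w => ?_
      rw [Module.End.mul_apply, Module.End.mul_apply, hexpand w, map_add, map_smul, map_smul, hSx, hSx]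
      simp only [map_add, map_smul, hxA, LinearMap.add_apply, LinearMap.smul_apply, hyapply]
      module
    set S' : Module.End ℂ W := s 0 0 • P 0 0 + s 0 1 • P 0 1 + s 1 0 • P 1 0 + s 1 1 • P 1 1 with hS'def
    have hcommS' : ∀ Y : Module.End ℂ W, (∀ a c, P a c * Y = Y * P a c) → S' * Y = Y * S' := fun Y hY => by
      rw [hS'def, add_mul, add_mul, add_mul, mul_add, mul_add, mul_add, smul_mul_assoc, smul_mul_assoc,
        smul_mul_assoc, smul_mul_assoc, mul_smul_comm, mul_smul_comm, mul_smul_comm, mul_smul_comm, hY, hY, hY, hY]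
    refine ⟨s 0 0, s 0 1, s 1 0, s 1 1, hdet' S S' hSe hSC hSE hSU hSV
      (hcommS' e fun a c => (hPcomm a c).1) (hcommS' C fun a c => (hPcomm a c).2.1)
      (hcommS' E₁ fun a c => (hPcomm a c).2.2.1) (hcommS' U fun a c => (hPcomm a c).2.2.2.1)
      (hcommS' V fun a c => (hPcomm a c).2.2.2.2) ?_⟩
    rw [hblk, hS'def, mul_add, mul_add, mul_add, add_mul, add_mul, add_mul, mul_smul_comm, mul_smul_comm,
      mul_smul_comm, mul_smul_comm, smul_mul_assoc, smul_mul_assoc, smul_mul_assoc, smul_mul_assoc, hPblk, hPblk,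
      hPblk, hPblk]
  -- assemble
  refine ⟨P 0 0, P 0 1, P 1 0, P 1 1, ⟨hP𝔊 0 0, hP𝔊 0 1, hP𝔊 1 0, hP𝔊 1 1⟩, ?_, ?_, ?_, hPsum, htrace, hspan⟩
  · intro Q hQ
    simp only [Set.mem_insert_iff, Set.mem_singleton_iff] at hQ
    rcases hQ with rfl | rfl | rfl | rfl <;> exact hPcomm _ _
  · refine ⟨?_, ?_, ?_, ?_, ?_, ?_, ?_, ?_⟩ <;> rw [hPprod] <;> simp
  · refine ⟨?_, ?_, ?_, ?_, ?_, ?_, ?_, ?_⟩ <;> rw [hPprod] <;> simp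

end HodgeStructure

end Literature.AlgebraicGeometry.Motives

end
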